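import Summits.MatrixMultiplication.MatrixMultiplication.Theorems.SoloInformedTwistedTPPFiveTerm
import HarnessLib

/-!
# Few-multiplier TPP stability, III: averaging over base triples and cleaning

Solo-informed seat (MatrixMultiplication), gen 104; dossier `paper/theoremB2.md` §7 (Theorem C2),
step (4).

`exists_good_base`: for a twisted realization of `⟨n,n,n⟩` (part II) with fixed-point-free multiplier
action, some base triple `(i₀, j₀, k₀)` has few BAD CELLS: the number of `(i,k)` with non-zero
`φ`-holonomy on `{i,i₀}×{k,k₀}` in slice `j₀`, plus the number of `(j,k)` with non-zero `ψ`-holonomy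
on `{j,j₀}×{k,k₀}` in slice `i₀`, plus the number of `(i,j)` with non-zero `(ψ-φ)`-holonomy on
`{i,i₀}×{j,j₀}` in slice `k₀`, is at most `3|A|⁵·n` (sum the five-term lemma over all rectangles and
average over the `n³` base triples).

`cleaning`: abstract comb lemma — given three bad-cell sets `B₁ ⊆ X×X` (cells `(i,k)`), `B₂` (cells
`(j,k)`), `B₃` (cells `(i,j)`) whose rows and columns through the base indices are empty, and
`(L+1)(s + sL) + (|B₁|+|B₂|+|B₃|) ≤ (L+1)|X|`, there are `I' ∋ i₀`, `J' ∋ j₀` of size `s` and `K' ∋ k₀`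
with `|X| ≤ |K'| + 2sL` such that `I'×K'`, `J'×K'`, `I'×J'` avoid `B₁, B₂, B₃` (light rows, then delete
the neighbourhoods).
References: CohnUmans2013 (arXiv:1207.6528) Def. 12, §5, Conj. 21; this work (Theorem C2).
-/

noncomputable section

open scoped BigOperators
open Finset

namespace Summit.MatrixMultiplication.MatrixMultiplication.Theorems.TwistedTPP

namespace TwistedRealization

variable {A S : Type*} [AddCommGroup A] [AddCommGroup S]

/-- **Averaging over base triples** (Theorem C2, step (4a)): some base triple has at most `3|A|⁵ n`
bad cells in its three slices. [this work] -/
theorem exists_good_base [Fintype A] [DecidableEq A] {n : ℕ} (hn : 0 < n)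
    (R : TwistedRealization A S (Fin n) (Fin n) (Fin n))
    (hfpf : ∀ g : A, g ≠ 0 → ∀ x : S, R.sm g x = x → x = 0) :
    ∃ i₀ j₀ k₀ : Fin n,
      (Finset.univ.filter fun p : Fin n × Fin n =>
          R.φ p.1 j₀ p.2 - R.φ p.1 j₀ k₀ - R.φ i₀ j₀ p.2 + R.φ i₀ j₀ k₀ ≠ 0).card
      + (Finset.univ.filter fun p : Fin n × Fin n =>
          R.ψ i₀ p.1 p.2 - R.ψ i₀ p.1 k₀ - R.ψ i₀ j₀ p.2 + R.ψ i₀ j₀ k₀ ≠ 0).card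
      + (Finset.univ.filter fun p : Fin n × Fin n =>
          (R.ψ p.1 p.2 k₀ - R.φ p.1 p.2 k₀) - (R.ψ p.1 j₀ k₀ - R.φ p.1 j₀ k₀)
            - (R.ψ i₀ p.2 k₀ - R.φ i₀ p.2 k₀) + (R.ψ i₀ j₀ k₀ - R.φ i₀ j₀ k₀) ≠ 0).card
      ≤ 3 * Fintype.card A ^ 5 * n := by
  set m := Fintype.card A with hm
  -- the three bad-cell counts as functions of the base triple
  set c₁ : Fin n → Fin n → Fin n → ℕ := fun i₀ j₀ k₀ =>
    (Finset.univ.filter fun p : Fin n × Fin n =>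
      R.φ p.1 j₀ p.2 - R.φ p.1 j₀ k₀ - R.φ i₀ j₀ p.2 + R.φ i₀ j₀ k₀ ≠ 0).card with hc₁
  set c₂ : Fin n → Fin n → Fin n → ℕ := fun i₀ j₀ k₀ =>
    (Finset.univ.filter fun p : Fin n × Fin n =>
      R.ψ i₀ p.1 p.2 - R.ψ i₀ p.1 k₀ - R.ψ i₀ j₀ p.2 + R.ψ i₀ j₀ k₀ ≠ 0).card with hc₂
  set c₃ : Fin n → Fin n → Fin n → ℕ := fun i₀ j₀ k₀ =>
    (Finset.univ.filter fun p : Fin n × Fin n =>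
      (R.ψ p.1 p.2 k₀ - R.φ p.1 p.2 k₀) - (R.ψ p.1 j₀ k₀ - R.φ p.1 j₀ k₀)
        - (R.ψ i₀ p.2 k₀ - R.φ i₀ p.2 k₀) + (R.ψ i₀ j₀ k₀ - R.φ i₀ j₀ k₀) ≠ 0).card with hc₃
  -- sums of the three counts over all base triples
  have h₁ : ∑ i₀, ∑ j₀, ∑ k₀, c₁ i₀ j₀ k₀ ≤ n * (n * (n * n * m ^ 5)) := by
    have hx : ∑ i₀, ∑ j₀, ∑ k₀, c₁ i₀ j₀ k₀ = ∑ i₀ : Fin n, ∑ k₀ : Fin n, ∑ p : Fin n × Fin n,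
        ∑ j₀ : Fin n, (if R.φ p.1 j₀ p.2 - R.φ p.1 j₀ k₀ - R.φ i₀ j₀ p.2 + R.φ i₀ j₀ k₀ ≠ 0
          then 1 else 0) := by
      refine Finset.sum_congr rfl fun i₀ _ => ?_
      simp only [hc₁, Finset.card_filter]
      rw [Finset.sum_comm]
      exact Finset.sum_congr rfl fun k₀ _ => Finset.sum_comm
    rw [hx]
    have hb : ∀ (i₀ k₀ : Fin n) (p : Fin n × Fin n),
        (∑ j₀ : Fin n, (if R.φ p.1 j₀ p.2 - R.φ p.1 j₀ k₀ - R.φ i₀ j₀ p.2 + R.φ i₀ j₀ k₀ ≠ 0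
          then 1 else 0)) ≤ m ^ 5 := fun i₀ k₀ p => by
      rw [← Finset.card_filter]; exact R.card_bad_slices_le hfpf p.1 i₀ p.2 k₀
    calc _ ≤ ∑ _i₀ : Fin n, ∑ _k₀ : Fin n, ∑ _p : Fin n × Fin n, m ^ 5 :=
          Finset.sum_le_sum fun i₀ _ => Finset.sum_le_sum fun k₀ _ =>
            Finset.sum_le_sum fun p _ => hb i₀ k₀ p
      _ = _ := by simp [Finset.sum_const, Finset.card_univ, Fintype.card_prod]
  have h₂ : ∑ i₀, ∑ j₀, ∑ k₀, c₂ i₀ j₀ k₀ ≤ n * (n * (n * n * m ^ 5)) := by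
    have hx : ∑ i₀, ∑ j₀, ∑ k₀, c₂ i₀ j₀ k₀ = ∑ j₀ : Fin n, ∑ k₀ : Fin n, ∑ p : Fin n × Fin n,
        ∑ i₀ : Fin n, (if R.ψ i₀ p.1 p.2 - R.ψ i₀ p.1 k₀ - R.ψ i₀ j₀ p.2 + R.ψ i₀ j₀ k₀ ≠ 0
          then 1 else 0) := by
      simp only [hc₂, Finset.card_filter]
      rw [Finset.sum_comm]
      refine Finset.sum_congr rfl fun j₀ _ => ?_
      rw [Finset.sum_comm]
      exact Finset.sum_congr rfl fun k₀ _ => Finset.sum_comm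
    rw [hx]
    have hb : ∀ (j₀ k₀ : Fin n) (p : Fin n × Fin n),
        (∑ i₀ : Fin n, (if R.ψ i₀ p.1 p.2 - R.ψ i₀ p.1 k₀ - R.ψ i₀ j₀ p.2 + R.ψ i₀ j₀ k₀ ≠ 0
          then 1 else 0)) ≤ m ^ 5 := fun j₀ k₀ p => by
      rw [← Finset.card_filter]; exact R.card_bad_slices_le_psi hfpf p.1 j₀ p.2 k₀
    calc _ ≤ ∑ _j₀ : Fin n, ∑ _k₀ : Fin n, ∑ _p : Fin n × Fin n, m ^ 5 :=
          Finset.sum_le_sum fun j₀ _ => Finset.sum_le_sum fun k₀ _ =>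
            Finset.sum_le_sum fun p _ => hb j₀ k₀ p
      _ = _ := by simp [Finset.sum_const, Finset.card_univ, Fintype.card_prod]
  have h₃ : ∑ i₀, ∑ j₀, ∑ k₀, c₃ i₀ j₀ k₀ ≤ n * (n * (n * n * m ^ 5)) := by
    have hx : ∑ i₀, ∑ j₀, ∑ k₀, c₃ i₀ j₀ k₀ = ∑ i₀ : Fin n, ∑ j₀ : Fin n, ∑ p : Fin n × Fin n,
        ∑ k₀ : Fin n, (if (R.ψ p.1 p.2 k₀ - R.φ p.1 p.2 k₀) - (R.ψ p.1 j₀ k₀ - R.φ p.1 j₀ k₀)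
            - (R.ψ i₀ p.2 k₀ - R.φ i₀ p.2 k₀) + (R.ψ i₀ j₀ k₀ - R.φ i₀ j₀ k₀) ≠ 0
          then 1 else 0) := by
      simp only [hc₃, Finset.card_filter]
      refine Finset.sum_congr rfl fun i₀ _ => ?_
      exact Finset.sum_congr rfl fun j₀ _ => Finset.sum_comm
    rw [hx]
    have hb : ∀ (i₀ j₀ : Fin n) (p : Fin n × Fin n),
        (∑ k₀ : Fin n, (if (R.ψ p.1 p.2 k₀ - R.φ p.1 p.2 k₀) - (R.ψ p.1 j₀ k₀ - R.φ p.1 j₀ k₀)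
            - (R.ψ i₀ p.2 k₀ - R.φ i₀ p.2 k₀) + (R.ψ i₀ j₀ k₀ - R.φ i₀ j₀ k₀) ≠ 0
          then 1 else 0)) ≤ m ^ 5 := fun i₀ j₀ p => by
      rw [← Finset.card_filter]; exact R.card_bad_slices_le_theta hfpf p.1 i₀ p.2 j₀
    calc _ ≤ ∑ _i₀ : Fin n, ∑ _j₀ : Fin n, ∑ _p : Fin n × Fin n, m ^ 5 :=
          Finset.sum_le_sum fun i₀ _ => Finset.sum_le_sum fun j₀ _ =>
            Finset.sum_le_sum fun p _ => hb i₀ j₀ p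
      _ = _ := by simp [Finset.sum_const, Finset.card_univ, Fintype.card_prod]
  -- average over the `n³` base triples
  have htot : ∑ t : Fin n × Fin n × Fin n, (c₁ t.1 t.2.1 t.2.2 + c₂ t.1 t.2.1 t.2.2
      + c₃ t.1 t.2.1 t.2.2) ≤ ∑ _t : Fin n × Fin n × Fin n, 3 * m ^ 5 * n := by
    have hl : ∑ t : Fin n × Fin n × Fin n, (c₁ t.1 t.2.1 t.2.2 + c₂ t.1 t.2.1 t.2.2
        + c₃ t.1 t.2.1 t.2.2) = ∑ i₀, ∑ j₀, ∑ k₀, c₁ i₀ j₀ k₀ + ∑ i₀, ∑ j₀, ∑ k₀, c₂ i₀ j₀ k₀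
        + ∑ i₀, ∑ j₀, ∑ k₀, c₃ i₀ j₀ k₀ := by
      simp only [Fintype.sum_prod_type, Finset.sum_add_distrib]
    rw [hl]
    have hr : ∑ _t : Fin n × Fin n × Fin n, 3 * m ^ 5 * n = 3 * (n * (n * (n * n * m ^ 5))) := by
      simp [Finset.sum_const, Finset.card_univ, Fintype.card_prod]; ring
    rw [hr]
    omega
  haveI : Nonempty (Fin n) := ⟨⟨0, hn⟩⟩
  obtain ⟨t, -, ht⟩ := Finset.exists_le_of_sum_le (Finset.univ_nonempty) htot
  exact ⟨t.1, t.2.1, t.2.2, ht⟩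

end TwistedRealization

/-- **Cleaning** (Theorem C2, step (4b)), abstract form: three bad-cell sets with empty rows/columns
through the base indices and small total size leave clean boxes `I'×K'`, `J'×K'`, `I'×J'` with
`|I'| = |J'| = s` and `|X| ≤ |K'| + 2sL`. [this work] -/
theorem cleaning {X : Type*} [Fintype X] [DecidableEq X] (B₁ B₂ B₃ : Finset (X × X))
    (i₀ j₀ k₀ : X) (e1 : ∀ k, (i₀, k) ∉ B₁) (e1' : ∀ i, (i, k₀) ∉ B₁) (e2 : ∀ k, (j₀, k) ∉ B₂)
    (e2' : ∀ j, (j, k₀) ∉ B₂) (e3 : ∀ j, (i₀, j) ∉ B₃) (e3' : ∀ i, (i, j₀) ∉ B₃)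
    (s L : ℕ) (hs : 0 < s)
    (havail : (L + 1) * (s + s * L) + (B₁.card + B₂.card + B₃.card) ≤ (L + 1) * Fintype.card X) :
    ∃ I' J' K' : Finset X, i₀ ∈ I' ∧ j₀ ∈ J' ∧ k₀ ∈ K' ∧ I'.card = s ∧ J'.card = s ∧
      Fintype.card X ≤ K'.card + 2 * s * L ∧
      (∀ i ∈ I', ∀ k ∈ K', (i, k) ∉ B₁) ∧ (∀ j ∈ J', ∀ k ∈ K', (j, k) ∉ B₂) ∧
      (∀ i ∈ I', ∀ j ∈ J', (i, j) ∉ B₃) := by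
  -- degrees and neighbourhoods
  set row : Finset (X × X) → X → Finset (X × X) := fun B x => B.filter fun p => p.1 = x with hrow
  set nb : Finset (X × X) → X → Finset X := fun B x => (row B x).image Prod.snd with hnb
  have hnb_card : ∀ B x, (nb B x).card ≤ (row B x).card := fun B x => Finset.card_image_le
  have mem_nb : ∀ B x y, (x, y) ∈ B → y ∈ nb B x := fun B x y h => by
    simp only [hnb, hrow, Finset.mem_image, Finset.mem_filter]
    exact ⟨(x, y), ⟨h, rfl⟩, rfl⟩
  -- total degree identity: `|B| = Σ_x |row B x|`
  have hdeg : ∀ B : Finset (X × X), B.card = ∑ x, (row B x).card := fun B =>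
    Finset.card_eq_sum_card_fiberwise (f := Prod.fst) (fun p _ => Finset.mem_univ _)
  -- heavy indices are few: `(L+1)·#{x : L < deg x} ≤ Σ deg`
  have heavy_few : ∀ deg : X → ℕ,
      (L + 1) * (Finset.univ.filter fun x => L < deg x).card ≤ ∑ x, deg x := fun deg => by
    calc (L + 1) * (Finset.univ.filter fun x => L < deg x).card
        = ∑ _x ∈ Finset.univ.filter (fun x => L < deg x), (L + 1) := by
          rw [Finset.sum_const, smul_eq_mul, mul_comm]
      _ ≤ ∑ x ∈ Finset.univ.filter (fun x => L < deg x), deg x :=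
          Finset.sum_le_sum fun x hx => (Finset.mem_filter.1 hx).2
      _ ≤ ∑ x, deg x :=
          Finset.sum_le_sum_of_subset_of_nonneg (Finset.filter_subset _ _) fun _ _ _ => Nat.zero_le _
  have light_card : ∀ deg : X → ℕ, (L + 1) * Fintype.card X ≤
      (L + 1) * (Finset.univ.filter fun x => deg x ≤ L).card + ∑ x, deg x := fun deg => by
    have hsplit := Finset.card_filter_add_card_filter_not
      (s := (Finset.univ : Finset X)) (fun x => deg x ≤ L)
    have hneg : (Finset.univ.filter fun x => ¬deg x ≤ L) = Finset.univ.filter fun x => L < deg x :=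
      Finset.filter_congr fun x _ => by simp only [not_le]
    rw [hneg, Finset.card_univ] at hsplit
    have := heavy_few deg
    nlinarith [hsplit]
  -- Step 1: `I'` = `s` light rows (w.r.t. `B₁` and `B₃`) including `i₀`
  set degI : X → ℕ := fun i => (row B₁ i).card + (row B₃ i).card with hdegI
  have hdegI_sum : ∑ i, degI i = B₁.card + B₃.card := by
    simp only [hdegI, Finset.sum_add_distrib, ← hdeg]
  have hi₀light : degI i₀ = 0 := by
    have h1 : (row B₁ i₀).card = 0 := by
      simp only [hrow, Finset.card_eq_zero, Finset.filter_eq_empty_iff]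
      rintro ⟨x, y⟩ hx rfl; exact e1 y hx
    have h3 : (row B₃ i₀).card = 0 := by
      simp only [hrow, Finset.card_eq_zero, Finset.filter_eq_empty_iff]
      rintro ⟨x, y⟩ hx rfl; exact e3 y hx
    simp only [hdegI, h1, h3]
  set lightI := Finset.univ.filter fun i => degI i ≤ L with hlightI
  have hi₀mem : i₀ ∈ lightI := by simp [hlightI, hi₀light]
  have hlightI_card : s ≤ lightI.card := by
    have h := light_card degI
    rw [hdegI_sum, ← hlightI] at h
    have h2 : (L + 1) * (s + s * L) ≤ (L + 1) * lightI.card := by linarith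
    have h3 := Nat.le_of_mul_le_mul_left h2 (Nat.succ_pos L)
    exact le_trans (Nat.le_add_right _ _) h3
  obtain ⟨T₁, hT₁sub, hT₁card⟩ := Finset.exists_subset_card_eq (s := lightI.erase i₀) (n := s - 1)
    (by rw [Finset.card_erase_of_mem hi₀mem]; omega)
  set I' := insert i₀ T₁ with hI'
  have hi₀T₁ : i₀ ∉ T₁ := fun h => by simpa using hT₁sub h
  have hI'card : I'.card = s := by rw [hI', Finset.card_insert_of_notMem hi₀T₁, hT₁card]; omega
  have hI'light : ∀ i ∈ I', degI i ≤ L := by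
    intro i hi
    rw [hI', Finset.mem_insert] at hi
    rcases hi with rfl | hi
    · rw [hi₀light]; exact Nat.zero_le _
    · exact (Finset.mem_filter.1 (Finset.mem_of_mem_erase (hT₁sub hi))).2
  -- Step 2: `J'` = `s` light rows of `B₂`, outside the `B₃`-neighbourhood of `I'`, including `j₀`
  set FJ := I'.biUnion fun i => nb B₃ i with hFJ
  have hFJcard : FJ.card ≤ s * L := by
    calc FJ.card ≤ ∑ i ∈ I', (nb B₃ i).card := Finset.card_biUnion_le
      _ ≤ ∑ i ∈ I', L := Finset.sum_le_sum fun i hi =>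
          (hnb_card B₃ i).trans ((Nat.le_add_left _ _).trans (hI'light i hi))
      _ = s * L := by rw [Finset.sum_const, smul_eq_mul, hI'card]
  have hj₀FJ : j₀ ∉ FJ := by
    simp only [hFJ, hnb, hrow, Finset.mem_biUnion, Finset.mem_image, Finset.mem_filter, not_exists,
      not_and]
    rintro i - ⟨x, y⟩ ⟨hx, rfl⟩ rfl
    exact e3' x hx
  set degJ : X → ℕ := fun j => (row B₂ j).card with hdegJ
  have hdegJ_sum : ∑ j, degJ j = B₂.card := by simp only [hdegJ, ← hdeg]
  have hj₀light : degJ j₀ = 0 := by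
    simp only [hdegJ, hrow, Finset.card_eq_zero, Finset.filter_eq_empty_iff]
    rintro ⟨x, y⟩ hx rfl; exact e2 y hx
  set candJ := (Finset.univ.filter fun j => degJ j ≤ L) \ FJ with hcandJ
  have hj₀cand : j₀ ∈ candJ := by
    simp only [hcandJ, Finset.mem_sdiff, Finset.mem_filter, Finset.mem_univ, true_and, hj₀light]
    exact ⟨Nat.zero_le _, hj₀FJ⟩
  have hcandJ_card : s ≤ candJ.card := by
    have h := light_card degJ
    rw [hdegJ_sum] at h
    have hsd : (Finset.univ.filter fun j => degJ j ≤ L).card ≤ candJ.card + FJ.card := by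
      rw [hcandJ]; exact Finset.card_le_card_sdiff_add_card
    have h2 : (L + 1) * (s + s * L) ≤ (L + 1) * (candJ.card + s * L) := by nlinarith
    have h3 := Nat.le_of_mul_le_mul_left h2 (Nat.succ_pos L)
    omega
  obtain ⟨T₂, hT₂sub, hT₂card⟩ := Finset.exists_subset_card_eq (s := candJ.erase j₀) (n := s - 1)
    (by rw [Finset.card_erase_of_mem hj₀cand]; omega)
  set J' := insert j₀ T₂ with hJ'
  have hj₀T₂ : j₀ ∉ T₂ := fun h => by simpa using hT₂sub h
  have hJ'card : J'.card = s := by rw [hJ', Finset.card_insert_of_notMem hj₀T₂, hT₂card]; omega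
  have hJ'cand : ∀ j ∈ J', j ∈ candJ := by
    intro j hj
    rw [hJ', Finset.mem_insert] at hj
    rcases hj with rfl | hj
    · exact hj₀cand
    · exact Finset.mem_of_mem_erase (hT₂sub hj)
  have hJ'light : ∀ j ∈ J', degJ j ≤ L := fun j hj =>
    (Finset.mem_filter.1 (Finset.mem_sdiff.1 (hJ'cand j hj)).1).2
  have hJ'FJ : ∀ j ∈ J', j ∉ FJ := fun j hj => (Finset.mem_sdiff.1 (hJ'cand j hj)).2
  -- Step 3: `K'` = everything outside the `B₁`-neighbourhood of `I'` and the `B₂`-neighbourhood of `J'`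
  set NK := (I'.biUnion fun i => nb B₁ i) ∪ J'.biUnion fun j => nb B₂ j with hNK
  have hNKcard : NK.card ≤ 2 * s * L := by
    calc NK.card ≤ (I'.biUnion fun i => nb B₁ i).card + (J'.biUnion fun j => nb B₂ j).card :=
          Finset.card_union_le _ _
      _ ≤ ∑ i ∈ I', (nb B₁ i).card + ∑ j ∈ J', (nb B₂ j).card :=
          add_le_add Finset.card_biUnion_le Finset.card_biUnion_le
      _ ≤ ∑ _i ∈ I', L + ∑ _j ∈ J', L := by
          gcongr with i hi j hj
          · exact (hnb_card B₁ i).trans ((Nat.le_add_right _ _).trans (hI'light i hi))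
          · exact (hnb_card B₂ j).trans (hJ'light j hj)
      _ = 2 * s * L := by rw [Finset.sum_const, Finset.sum_const, smul_eq_mul, hI'card, hJ'card]; ring
  set K' := Finset.univ \ NK with hK'
  have hK'card : Fintype.card X ≤ K'.card + 2 * s * L := by
    have : (Finset.univ : Finset X).card ≤ K'.card + NK.card := by
      rw [hK']; exact Finset.card_le_card_sdiff_add_card
    rw [Finset.card_univ] at this
    omega
  have hk₀K' : k₀ ∈ K' := by
    simp only [hK', hNK, hnb, hrow, Finset.mem_sdiff, Finset.mem_univ, true_and, Finset.mem_union,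
      Finset.mem_biUnion, Finset.mem_image, Finset.mem_filter, not_or, not_exists, not_and]
    constructor
    · rintro i - ⟨x, y⟩ ⟨hx, rfl⟩ rfl; exact e1' x hx
    · rintro j - ⟨x, y⟩ ⟨hx, rfl⟩ rfl; exact e2' x hx
  refine ⟨I', J', K', by simp [hI'], by simp [hJ'], hk₀K', hI'card, hJ'card, hK'card, ?_, ?_, ?_⟩
  · intro i hi k hk hik
    have : k ∈ NK := Finset.mem_union_left _ (Finset.mem_biUnion.2 ⟨i, hi, mem_nb B₁ i k hik⟩)
    exact (Finset.mem_sdiff.1 hk).2 this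
  · intro j hj k hk hjk
    have : k ∈ NK := Finset.mem_union_right _ (Finset.mem_biUnion.2 ⟨j, hj, mem_nb B₂ j k hjk⟩)
    exact (Finset.mem_sdiff.1 hk).2 this
  · intro i hi j hj hij
    exact hJ'FJ j hj (Finset.mem_biUnion.2 ⟨i, hi, mem_nb B₃ i j hij⟩)

end Summit.MatrixMultiplication.MatrixMultiplication.Theorems.TwistedTPP
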